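import Summits.Ventures.YMGap.RobustBall.CentreTubeLink
import Summits.Ventures.YMGap.RobustBall.StringTensionCentreTubeFR
import HarnessLib

/-!
# RobustBall/CentreTubeLinkRows — rows, cells and limit-state (string-tension) readings of the QUANTITATIVE centre tube
# `AreaLawCentreTubeFR N d β ε₀ ε₁ r` under `2(d−1)N|β| + √N ε₁ < 1`

HONEST FRAMING: venture file of the cell `pub-ymgap` (QuantumFields programme), track ROBUST-BALL / DS seat ds-4 (g9).
Strong-coupling LATTICE statements; centre-projected `ℤ_N` flux picture; nothing about the continuum, a spectral mass gap, or Clay.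

WHAT.  `CentreTubeLink.areaLawCentreTubeFR_of_lip` proves the countersigned currency `AreaLawCentreTubeFR N d β ε₀ ε₁ r` under the
QUANTITATIVE hypothesis `2(d−1)N|β| + √N ε₁ < 1` (no counting constant; every range `r`, every `ε₀`).  This file records:
* ROWS: SU(2) `d = 4` (`6 β_W + √2 ε₁ < 1`), SU(2) `d = 3` (`4 β_W + √2 ε₁ < 1`), SU(3) `d = 4` (`6 β_W + √3 ε₁ < 1`), every `N ≥ 2` in 't Hooft
  normalisation (`6 N² |βt| + √N ε₁ < 1`);
* CELLS: SU(2) `d = 4` `(β_W, ε₁) = (1/8, 1/6)`, `(1/10, 1/4)`; SU(2) `d = 3` `(1/8, 1/3)`; SU(3) `d = 4` `(1/8, 1/7)` — for EVERY `r` and every `ε₀`;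
* LIMIT STATES (via gen 8's `stringTension_centreTubeFR` / `hasAreaLawWith_centreTubeFR`, schema = rb-p2's `hasAreaLawWith_of_torusBound`): for
  `d ≥ 2`, ONE `(C, c)`, `c > 0`, such that every limit state of every family eventually of the form `W_b + W` (`W_b` twist-blind,
  `W ∈ ClusterDomainFR ε₀ ε₁ r`) obeys `HasAreaLawWith μ χ_N C c`, `HasAreaLawState`, `σ ≥ c` WHENEVER the string tension exists, `IsConfining` given
  existence (`stringTension_centreTubeFR_of_lip`); the SU(2) `d = 4` row and the cell `(1/8, 1/6)`.
WHAT IS NOT CLAIMED.  EXISTENCE of the string tension of a limit state; the `β`-window is the `ℤ_N`-layer window (not moved); rate a door artefact.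

References (mechanism, AS PRINTED): J. Fröhlich, Phys. Lett. B 83 (1979) 195–198 [Frohlich1979ZN]; G. Mack, V. B. Petkova, Ann. Phys. 123 (1979)
442–467 [MackPetkova1979]; B. Durhuus, J. Fröhlich, Comm. Math. Phys. 75 (1980) 103; E. Seiler, LNP 159 (1982) §2.
-/

noncomputable section

open MeasureTheory Filter Topology
open Literature.MathematicalPhysics.QuantumLattice
open Literature.MathematicalPhysics.QuantumFieldTheory hiding ZdEdge Site
open Literature.Barriers.QuantumFields (suFundStringTension suFundStringTension_def)

namespace Summit.Ventures.YMGap.RobustBall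

variable {d N : ℕ}

/-! ### Rows and cells -/

/-- **SU(2), `d = 4`, every range `r`**: `6 β_W + √2 ε₁ < 1 ⇒ AreaLawCentreTubeFR 2 4 β ε₀ ε₁ r` (`β = β_W/2`; every `ε₀`). [folklore] -/
theorem su2_areaLawCentreTubeFR_lip_dim4 {β ε₁ : ℝ} (ε₀ : ℝ) (r : ℕ) (h : 6 * (2 * |β|) + Real.sqrt 2 * ε₁ < 1) :
    AreaLawCentreTubeFR 2 4 β ε₀ ε₁ r :=
  areaLawCentreTubeFR_of_lip (le_refl 2) ε₀ r (by push_cast; linarith)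

/-- **SU(2), `d = 3`, every range `r`**: `4 β_W + √2 ε₁ < 1 ⇒ AreaLawCentreTubeFR 2 3 β ε₀ ε₁ r`. [folklore] -/
theorem su2_areaLawCentreTubeFR_lip_dim3 {β ε₁ : ℝ} (ε₀ : ℝ) (r : ℕ) (h : 4 * (2 * |β|) + Real.sqrt 2 * ε₁ < 1) :
    AreaLawCentreTubeFR 2 3 β ε₀ ε₁ r :=
  areaLawCentreTubeFR_of_lip (le_refl 2) ε₀ r (by push_cast; linarith)

/-- **SU(3), `d = 4`, every range `r`**: `6 β_W + √3 ε₁ < 1 ⇒ AreaLawCentreTubeFR 3 4 β ε₀ ε₁ r` (`β = β_W/3`). [folklore] -/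
theorem su3_areaLawCentreTubeFR_lip_dim4 {β ε₁ : ℝ} (ε₀ : ℝ) (r : ℕ) (h : 6 * (3 * |β|) + Real.sqrt 3 * ε₁ < 1) :
    AreaLawCentreTubeFR 3 4 β ε₀ ε₁ r :=
  areaLawCentreTubeFR_of_lip (by norm_num) ε₀ r (by push_cast; linarith)

/-- **Every `N ≥ 2`, `d = 4`, 't Hooft normalisation** (`βt = β/N`, so `2(d−1)N|β| = 6N²|βt|`): `6 N² |βt| + √N ε₁ < 1 ⇒
AreaLawCentreTubeFR N 4 (N βt) ε₀ ε₁ r`. [folklore] -/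
theorem suN_areaLawCentreTubeFR_lip_dim4 [NeZero N] (hN : 2 ≤ N) {βt ε₁ : ℝ} (ε₀ : ℝ) (r : ℕ)
    (h : 6 * (N : ℝ) ^ 2 * |βt| + Real.sqrt N * ε₁ < 1) : AreaLawCentreTubeFR N 4 (N * βt) ε₀ ε₁ r :=
  areaLawCentreTubeFR_of_lip hN ε₀ r (by
    rw [abs_mul, Nat.abs_cast]; push_cast; nlinarith [Nat.cast_nonneg (α := ℝ) N])

/-- **CELL SU(2), `d = 4`, `(β_W, ε₁) = (1/8, 1/6)`**: `AreaLawCentreTubeFR 2 4 (1/16) ε₀ (1/6) r` for every `ε₀` and every range `r`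
(`3/4 + √2/6 < 1`). [folklore] -/
theorem su2_areaLawCentreTubeFR_lip_cell_oneEighth (ε₀ : ℝ) (r : ℕ) : AreaLawCentreTubeFR 2 4 (1 / 16) ε₀ (1 / 6) r :=
  su2_areaLawCentreTubeFR_lip_dim4 ε₀ r (by
    rw [abs_of_pos (by norm_num : (0 : ℝ) < 1 / 16)]; nlinarith [show Real.sqrt 2 < 3 / 2 by rw [Real.sqrt_lt' (by norm_num)]; norm_num])

/-- **CELL SU(2), `d = 4`, `(β_W, ε₁) = (1/10, 1/4)`**: `AreaLawCentreTubeFR 2 4 (1/20) ε₀ (1/4) r` for every `ε₀` and every range `r`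
(`3/5 + √2/4 < 1`). [folklore] -/
theorem su2_areaLawCentreTubeFR_lip_cell_oneTenth (ε₀ : ℝ) (r : ℕ) : AreaLawCentreTubeFR 2 4 (1 / 20) ε₀ (1 / 4) r :=
  su2_areaLawCentreTubeFR_lip_dim4 ε₀ r (by
    rw [abs_of_pos (by norm_num : (0 : ℝ) < 1 / 20)]; nlinarith [show Real.sqrt 2 < 3 / 2 by rw [Real.sqrt_lt' (by norm_num)]; norm_num])

/-- **CELL SU(2), `d = 3`, `(β_W, ε₁) = (1/8, 1/3)`**: `AreaLawCentreTubeFR 2 3 (1/16) ε₀ (1/3) r` (`1/2 + √2/3 < 1`). [folklore] -/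
theorem su2_areaLawCentreTubeFR_lip_cell_dim3_oneEighth (ε₀ : ℝ) (r : ℕ) : AreaLawCentreTubeFR 2 3 (1 / 16) ε₀ (1 / 3) r :=
  su2_areaLawCentreTubeFR_lip_dim3 ε₀ r (by
    rw [abs_of_pos (by norm_num : (0 : ℝ) < 1 / 16)]; nlinarith [show Real.sqrt 2 < 3 / 2 by rw [Real.sqrt_lt' (by norm_num)]; norm_num])

/-- **CELL SU(3), `d = 4`, `(β_W, ε₁) = (1/8, 1/7)`**: `AreaLawCentreTubeFR 3 4 (1/24) ε₀ (1/7) r` (`3/4 + √3/7 < 1`). [folklore] -/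
theorem su3_areaLawCentreTubeFR_lip_cell_oneEighth (ε₀ : ℝ) (r : ℕ) : AreaLawCentreTubeFR 3 4 (1 / 24) ε₀ (1 / 7) r :=
  su3_areaLawCentreTubeFR_lip_dim4 ε₀ r (by
    rw [abs_of_pos (by norm_num : (0 : ℝ) < 1 / 24)]; nlinarith [show Real.sqrt 3 < 7 / 4 by rw [Real.sqrt_lt' (by norm_num)]; norm_num])

/-! ### Limit states -/


/-- **STRING TENSION ON THE QUANTITATIVE CENTRE TUBE** (`d ≥ 2`, `N ≥ 2`, `2(d−1)N|β| + √N ε₁ < 1`; every `r`, `ε₀`): ONE pair `(C, c)`, `c > 0`,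
for every limit state of every eventually-`(W_b + W)` family (`W_b` twist-blind, `W ∈ ClusterDomainFR ε₀ ε₁ r`): `HasAreaLawWith`, `HasAreaLawState`,
`σ ≥ c` whenever the string tension exists, `IsConfining` given existence.  Existence of `σ` is NOT asserted. [folklore] -/
theorem stringTension_centreTubeFR_of_lip [NeZero d] [NeZero N] (hd : 2 ≤ d) (hN : 2 ≤ N) {β ε₁ : ℝ} (ε₀ : ℝ) (r : ℕ)
    (hβ : 2 * ((d - 1 : ℕ) : ℝ) * |β| * N + Real.sqrt N * ε₁ < 1) :
    ∃ C c : ℝ, 0 < c ∧ ∀ 𝓦 : PerturbationFamily d N,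
      (∀ᶠ L : ℕ in atTop, ∃ Wb W : Perturbation d (L + 1) N, IsTwistBlind Wb ∧ W ∈ ClusterDomainFR ε₀ ε₁ r ∧ 𝓦 L = Wb + W) →
        ∀ μ ∈ perturbedLimitPoints β 𝓦,
          HasAreaLawWith μ (fun g => normalisedCharacter N (fundamentalRep (Fin N) g)) C c ∧
          HasAreaLawState μ (fun g => normalisedCharacter N (fundamentalRep (Fin N) g)) ∧
          (∀ σ : ℝ, HasStringTension μ (fun g => normalisedCharacter N (fundamentalRep (Fin N) g)) σ → c ≤ σ) ∧
          ((∃ σ : ℝ, HasStringTension μ (fun g => normalisedCharacter N (fundamentalRep (Fin N) g)) σ) →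
            IsConfining μ (fun g => normalisedCharacter N (fundamentalRep (Fin N) g))) :=
  stringTension_centreTubeFR hd (areaLawCentreTubeFR_of_lip hN ε₀ r hβ)

/-- **SU(2), `d = 4`, every range `r`** (`6 β_W + √2 ε₁ < 1`): one `c > 0` with `HasAreaLawWith μ χ₂ C c` and `c ≤ suFundStringTension 2 μ` whenever
the string tension exists, for every limit state of every eventually-`(W_b + W)` family, `W_b` twist-blind, `W ∈ ClusterDomainFR ε₀ ε₁ r`. [folklore] -/
theorem su2_stringTension_centreTubeFR_lip_dim4 {β ε₀ ε₁ : ℝ} {r : ℕ} (h : 6 * (2 * |β|) + Real.sqrt 2 * ε₁ < 1) :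
    ∃ C c : ℝ, 0 < c ∧ ∀ 𝓦 : PerturbationFamily 4 2,
      (∀ᶠ L : ℕ in atTop, ∃ Wb W : Perturbation 4 (L + 1) 2, IsTwistBlind Wb ∧ W ∈ ClusterDomainFR ε₀ ε₁ r ∧ 𝓦 L = Wb + W) →
        ∀ μ ∈ perturbedLimitPoints β 𝓦,
          HasAreaLawWith μ (fun g => normalisedCharacter 2 (fundamentalRep (Fin 2) g)) C c ∧
          ((∃ σ : ℝ, HasStringTension μ (fun g => normalisedCharacter 2 (fundamentalRep (Fin 2) g)) σ) →
            c ≤ suFundStringTension 2 μ) := by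
  obtain ⟨C, c, hc, hA⟩ := hasAreaLawWith_centreTubeFR (N := 2) (by norm_num) (su2_areaLawCentreTubeFR_lip_dim4 ε₀ r h)
  refine ⟨C, c, hc, fun 𝓦 h𝓦 μ hμ => ⟨hA 𝓦 h𝓦 μ hμ, fun ⟨σ, hσ⟩ => ?_⟩⟩
  rw [suFundStringTension_def, hσ.stringTension_eq]
  exact (hA 𝓦 h𝓦 μ hμ).le_of_hasStringTension hσ

/-- **CELL SU(2), `d = 4`, `(β_W, ε₁) = (1/8, 1/6)`, every range `r`, every `ε₀`**: one `c > 0` with `HasAreaLawWith μ χ₂ C c` and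
`c ≤ suFundStringTension 2 μ` whenever the string tension exists, for every limit state of every eventually-`(W_b + W)` family at `β = 1/16`,
`W_b` twist-blind, `W ∈ ClusterDomainFR ε₀ (1/6) r`. [folklore] -/
theorem su2_stringTension_centreTubeFR_lip_cell_oneEighth (ε₀ : ℝ) (r : ℕ) :
    ∃ C c : ℝ, 0 < c ∧ ∀ 𝓦 : PerturbationFamily 4 2,
      (∀ᶠ L : ℕ in atTop, ∃ Wb W : Perturbation 4 (L + 1) 2,
        IsTwistBlind Wb ∧ W ∈ ClusterDomainFR ε₀ (1 / 6 : ℝ) r ∧ 𝓦 L = Wb + W) →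
        ∀ μ ∈ perturbedLimitPoints (1 / 16 : ℝ) 𝓦,
          HasAreaLawWith μ (fun g => normalisedCharacter 2 (fundamentalRep (Fin 2) g)) C c ∧
          ((∃ σ : ℝ, HasStringTension μ (fun g => normalisedCharacter 2 (fundamentalRep (Fin 2) g)) σ) →
            c ≤ suFundStringTension 2 μ) :=
  su2_stringTension_centreTubeFR_lip_dim4 (by
    rw [abs_of_pos (by norm_num : (0 : ℝ) < 1 / 16)]; nlinarith [show Real.sqrt 2 < 3 / 2 by rw [Real.sqrt_lt' (by norm_num)]; norm_num])

end Summit.Ventures.YMGap.RobustBall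

end
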